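import Summits.HubbardSuperconductivity.HubbardSuperconductivity.Theorems.SoloBlindCrutchAxis
import Literature.MathematicalPhysics.QuantumLattice.FreeFermiGasPairingCostLog
import Literature.MathematicalPhysics.QuantumLattice.FinDimSpectrumSectorGibbsLimit
import HarnessLib

/-!
# The corner `(U, g) → (0, 0)` of the crutch plane: a pair-density ceiling for EVERY ground state

Solo-blind lineage, Theorem 36 (generation 32). Along the BCS-crutch axis
`K_{U,g} = hubbardTorus 2 L 1 U - (g/L²) Δ_dᴴ Δ_d` (the lineage's Theorems 23–24, 29–30, 33–35,
file `SoloBlindCrutchAxis.lean` and successors) the summit `HubbardSuperconductivity` is equivalent to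
a slope condition at `g = 0⁺` for a fixed `U > 0`. This file closes the picture near the corner
`(U, g) = (0, 0)` from ABOVE, for every normalised sector ground state `φ` of `K_{U,g}` (`U, g ≥ 0`,
sector `(2n, S^z = 0)`, `n ≤ L²`), writing `Y = re ⟨φ, Δ_dᴴΔ_d φ⟩` and `y = Y/L⁴`:

* `crutch_groundState_kineticExcess_le` — the two-line energy balance
  `re⟨φ, H₀ φ⟩ ≤ E₀(sector) + U·L² + (g/L²)·Y` (test `K_{U,g}` on a free sector ground state; drop the
  non-negative interaction of `φ` and the non-positive crutch term of the test state);
* `crutch_groundState_pairDensity_opt` — with the kinetic pairing cost of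
  `FreeFermiGasPairingCostOptimal.lean` (`freeDWavePairing_costs_energy_opt_explicit`, all fillings):
  `a√a/32768 ≤ U + g·y` whenever `a L⁴ ≤ Y`, `a L² ≥ 4608`;
* `free_crutch_groundState_pairField_le` — at `U = 0`: `Y ≤ max (4608·L²) (2³⁰ g² L⁴)` for EVERY ground
  state of `K_{0,g}` and every `g ≥ 0` (order density `O(g²)`; at `g = 0` this is Theorem 4 for every
  family, with the constant `4608` of the Literature file);
* `crutch_groundState_pairDensity_log` / `free_crutch_groundState_exp_le` — at the summit's fillings
  (Fermi level in `[-4 + d₀, -d₀]`, hypotheses `hC1`/`hC2` exactly as in `FreeFermiGasPairingCostLog.lean`):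
  `√d₀·a/(4096·log(4 + 32/√a)) ≤ U + g·y`, hence at `U = 0`, `g > 0`, `Y ≥ 12800 L²`:
  `exp(√d₀/(4096 g)) ≤ 4 + 32/√y`, i.e. `y ≤ 1024/(e^{√d₀/(4096 g)} - 4)²` once the exponential exceeds `4`:
  the `U = 0` edge of the crutch plane carries order density `e^{-Θ(1/g)}` from above (from below:
  Theorems 29–30, `SoloBlindWeakCouplingCrutchLRO.lean`), uniformly over the ground-state manifold.

Inputs (kernel, Literature, not this lineage's): `freeDWavePairing_costs_energy_opt_explicit`,
`freeDWavePairing_costs_energy_log_explicit`, `szSector_groundState`, `minEnergyOn_le_rayleigh_of_mem`,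
`hubbardTorus_eq_zero_add_smul_interaction`, `re_expect_interaction_torus_mem_Icc`. Own content: the
energy balance and the algebra. No claim toward the summit: the edge `U = 0` is where the summit's
matrix is false (Theorem 4); the statement quantifies the failure along the whole edge and at the corner.
-/

namespace Summit.HubbardSuperconductivity.HubbardSuperconductivity.Theorems.CrutchCorner

open Matrix Literature.Probability.LatticeModels Literature.MathematicalPhysics.QuantumLattice
open scoped ComplexOrder

variable {L : ℕ} [NeZero L]

/-- Splitting of a Rayleigh quotient of `A + c • B` (`c` real) into real parts. -/
private theorem re_rayleigh_add_real_smul {ι : Type*} [Fintype ι] (A B : Matrix ι ι ℂ) (c : ℝ)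
    (v : ι → ℂ) :
    (star v ⬝ᵥ ((A + ((c : ℝ) : ℂ) • B) *ᵥ v)).re =
      (star v ⬝ᵥ (A *ᵥ v)).re + c * (star v ⬝ᵥ (B *ᵥ v)).re := by
  rw [add_mulVec, Matrix.smul_mulVec, dotProduct_add, dotProduct_smul, smul_eq_mul, Complex.add_re,
    Complex.re_ofReal_mul]

omit [NeZero L] in
/-- Splitting of the Hubbard Rayleigh quotient: `re⟨v, H_U v⟩ = re⟨v, H₀ v⟩ + U · re⟨v, D v⟩` with
`D = Σ_x n_{x↑} n_{x↓}`. -/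
private theorem re_rayleigh_hubbardTorus_split (U : ℝ) (v : Fock (Orb (FermionTorus 2 L))) :
    (star v ⬝ᵥ (hubbardTorus 2 L 1 U *ᵥ v)).re =
      (star v ⬝ᵥ (hubbardTorus 2 L 1 0 *ᵥ v)).re +
        U * (star v ⬝ᵥ ((∑ x : FermionTorus 2 L, numberOp x 0 * numberOp x 1 :
          Matrix (Finset (Orb (FermionTorus 2 L))) _ ℂ) *ᵥ v)).re := by
  rw [hubbardTorus_eq_zero_add_smul_interaction U]
  exact re_rayleigh_add_real_smul _ _ U v

/-- **Energy balance on the crutch plane.** `L ≥ 3`, `U ≥ 0`, `g ≥ 0`, `n ≤ L²`; `φ` a normalised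
ground state of `K_{U,g} = hubbardTorus 2 L 1 U - (g/L²) Δ_dᴴΔ_d` in the sector `(2n, S^z = 0)`. Then
the free kinetic excess of `φ` is at most `U·L² + (g/L²)·re⟨φ, Δ_dᴴΔ_d φ⟩`:
test `K_{U,g}` on a normalised FREE sector ground state `χ` (`re⟨χ,Kχ⟩ ≤ E₀ + U L²` since the crutch
term is `≤ 0` and `⟨D⟩_χ ≤ L²`) and drop `U⟨D⟩_φ ≥ 0`. [this work] -/
theorem crutch_groundState_kineticExcess_le (hL : 3 ≤ L) {U : ℝ} (hU : 0 ≤ U) {g : ℝ} (hg : 0 ≤ g)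
    {n : ℕ} (hn : n ≤ L ^ 2) {φ : Fock (Orb (FermionTorus 2 L))} (hφ1 : star φ ⬝ᵥ φ = 1)
    (hφ : IsGroundStateInSector
      (hubbardTorus 2 L 1 U + ((-(g / (L : ℝ) ^ 2) : ℝ) : ℂ) •
        ((pairField dWaveFormFactor L)ᴴ * pairField dWaveFormFactor L)) (2 * n) 0 φ) :
    (star φ ⬝ᵥ (hubbardTorus 2 L 1 0 *ᵥ φ)).re ≤
      (hubbardTorus 2 L 1 0).minEnergyOn (szSector (Λ := FermionTorus 2 L) (2 * n) 0) +
        U * (L : ℝ) ^ 2 +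
        g / (L : ℝ) ^ 2 *
          (star φ ⬝ᵥ (((pairField dWaveFormFactor L)ᴴ * pairField dWaveFormFactor L) *ᵥ φ)).re := by
  -- Hermitian operators
  have hOh : ((pairField dWaveFormFactor L)ᴴ * pairField dWaveFormFactor L).IsHermitian :=
    isHermitian_conjTranspose_mul_self _
  have hHU : (hubbardTorus 2 L 1 U).IsHermitian := LiebThm1.hamiltonian_isHermitian _ 1 U
  have hKh : (hubbardTorus 2 L 1 U + ((-(g / (L : ℝ) ^ 2) : ℝ) : ℂ) •
      ((pairField dWaveFormFactor L)ᴴ * pairField dWaveFormFactor L)).IsHermitian :=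
    isHermitian_add_ofReal_smul hHU hOh _
  -- a normalised free sector ground state `a • φ₀`
  have hn' : n ≤ Fintype.card (FermionTorus 2 L) := by simpa using hn
  obtain ⟨⟨φ₀, hφ₀S, hφ₀0, hHφ₀⟩, -⟩ := szSector_groundState (fermionTorusGraph 2 L) 1 0 hn'
  obtain ⟨a, -, ha1⟩ := exists_smul_unit hφ₀0
  have hχS : a • φ₀ ∈ szSector (Λ := FermionTorus 2 L) (2 * n) 0 := Submodule.smul_mem _ _ hφ₀S
  have hHχ : hubbardTorus 2 L 1 0 *ᵥ (a • φ₀) =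
      (((hubbardTorus 2 L 1 0).minEnergyOn (szSector (Λ := FermionTorus 2 L) (2 * n) 0) : ℝ) : ℂ) •
        (a • φ₀) := by
    rw [mulVec_smul, smul_comm]
    exact congrArg (a • ·) hHφ₀
  have hχfree : (star (a • φ₀) ⬝ᵥ (hubbardTorus 2 L 1 0 *ᵥ (a • φ₀))).re =
      (hubbardTorus 2 L 1 0).minEnergyOn (szSector (Λ := FermionTorus 2 L) (2 * n) 0) := by
    rw [hHχ, dotProduct_smul, smul_eq_mul, ha1, mul_one, Complex.ofReal_re]
  -- variational principle for `K` on `a • φ₀`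
  have hvar := minEnergyOn_le_rayleigh_of_mem hKh _ hχS ha1
  -- `re⟨φ, K φ⟩ = E_K`
  obtain ⟨-, -, hKφ⟩ := hφ
  have hφK : (star φ ⬝ᵥ ((hubbardTorus 2 L 1 U + ((-(g / (L : ℝ) ^ 2) : ℝ) : ℂ) •
      ((pairField dWaveFormFactor L)ᴴ * pairField dWaveFormFactor L)) *ᵥ φ)).re =
      (hubbardTorus 2 L 1 U + ((-(g / (L : ℝ) ^ 2) : ℝ) : ℂ) •
        ((pairField dWaveFormFactor L)ᴴ * pairField dWaveFormFactor L)).minEnergyOn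
          (szSector (Λ := FermionTorus 2 L) (2 * n) 0) := by
    rw [hKφ, dotProduct_smul, smul_eq_mul, hφ1, mul_one, Complex.ofReal_re]
  -- splittings of both Rayleigh quotients
  have hsφ := re_rayleigh_add_real_smul (hubbardTorus 2 L 1 U)
    ((pairField dWaveFormFactor L)ᴴ * pairField dWaveFormFactor L) (-(g / (L : ℝ) ^ 2)) φ
  have hsχ := re_rayleigh_add_real_smul (hubbardTorus 2 L 1 U)
    ((pairField dWaveFormFactor L)ᴴ * pairField dWaveFormFactor L) (-(g / (L : ℝ) ^ 2)) (a • φ₀)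
  have huφ := re_rayleigh_hubbardTorus_split (L := L) U φ
  have huχ := re_rayleigh_hubbardTorus_split (L := L) U (a • φ₀)
  -- signs
  have hDφ := (re_expect_interaction_torus_mem_Icc φ).1
  have hDχ := (re_expect_interaction_torus_mem_Icc (a • φ₀)).2
  rw [ha1, Complex.one_re, mul_one] at hDχ
  have hOχ : 0 ≤ (star (a • φ₀) ⬝ᵥ
      (((pairField dWaveFormFactor L)ᴴ * pairField dWaveFormFactor L) *ᵥ (a • φ₀))).re :=
    (posSemidef_conjTranspose_mul_self (pairField dWaveFormFactor L)).re_dotProduct_nonneg _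
  have hL0 : (0 : ℝ) < L := by exact_mod_cast (by omega : 0 < L)
  have hgL : 0 ≤ g / (L : ℝ) ^ 2 := by positivity
  have h1 : 0 ≤ g / (L : ℝ) ^ 2 * (star (a • φ₀) ⬝ᵥ
      (((pairField dWaveFormFactor L)ᴴ * pairField dWaveFormFactor L) *ᵥ (a • φ₀))).re :=
    mul_nonneg hgL hOχ
  have h2 : 0 ≤ U * (star φ ⬝ᵥ ((∑ x : FermionTorus 2 L, numberOp x 0 * numberOp x 1 :
      Matrix (Finset (Orb (FermionTorus 2 L))) _ ℂ) *ᵥ φ)).re := mul_nonneg hU hDφ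
  have h3 : U * (star (a • φ₀) ⬝ᵥ ((∑ x : FermionTorus 2 L, numberOp x 0 * numberOp x 1 :
      Matrix (Finset (Orb (FermionTorus 2 L))) _ ℂ) *ᵥ (a • φ₀))).re ≤ U * (L : ℝ) ^ 2 :=
    mul_le_mul_of_nonneg_left hDχ hU
  linarith

/-- **Theorem 36(a) (all fillings).** In the setting of `crutch_groundState_kineticExcess_le`, if the
ground state `φ` has `d`-wave pair density at least `a` (`a L⁴ ≤ re⟨φ, Δ_dᴴΔ_d φ⟩`, `a L² ≥ 4608`,
`a > 0`), then `a√a/32768 ≤ U + g · re⟨φ, Δ_dᴴΔ_d φ⟩/L⁴`: the kinetic pairing cost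
(`freeDWavePairing_costs_energy_opt_explicit`, Literature) against the energy balance. [this work] -/
theorem crutch_groundState_pairDensity_opt (hL : 3 ≤ L) {U : ℝ} (hU : 0 ≤ U) {g : ℝ} (hg : 0 ≤ g)
    {n : ℕ} (hn : n ≤ L ^ 2) {φ : Fock (Orb (FermionTorus 2 L))} (hφ1 : star φ ⬝ᵥ φ = 1)
    (hφ : IsGroundStateInSector
      (hubbardTorus 2 L 1 U + ((-(g / (L : ℝ) ^ 2) : ℝ) : ℂ) •
        ((pairField dWaveFormFactor L)ᴴ * pairField dWaveFormFactor L)) (2 * n) 0 φ)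
    {a : ℝ} (ha : 0 < a) (hLa : 4608 ≤ a * (L : ℝ) ^ 2)
    (hY : a * (L : ℝ) ^ 4 ≤
      (star φ ⬝ᵥ (((pairField dWaveFormFactor L)ᴴ * pairField dWaveFormFactor L) *ᵥ φ)).re) :
    a * Real.sqrt a / 32768 ≤
      U + g * ((star φ ⬝ᵥ (((pairField dWaveFormFactor L)ᴴ * pairField dWaveFormFactor L) *ᵥ φ)).re /
        (L : ℝ) ^ 4) := by
  have h1 := crutch_groundState_kineticExcess_le hL hU hg hn hφ1 hφ
  have h2 := freeDWavePairing_costs_energy_opt_explicit ha hL hLa hφ.1 hφ1 hY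
  have hL0 : (0 : ℝ) < L := by exact_mod_cast (by omega : 0 < L)
  have hL2 : (0 : ℝ) < (L : ℝ) ^ 2 := by positivity
  have key : a * Real.sqrt a / 32768 * (L : ℝ) ^ 2 ≤
      (U + g * ((star φ ⬝ᵥ (((pairField dWaveFormFactor L)ᴴ * pairField dWaveFormFactor L) *ᵥ
        φ)).re / (L : ℝ) ^ 4)) * (L : ℝ) ^ 2 := by
    have e : (U + g * ((star φ ⬝ᵥ (((pairField dWaveFormFactor L)ᴴ * pairField dWaveFormFactor L) *ᵥ
        φ)).re / (L : ℝ) ^ 4)) * (L : ℝ) ^ 2 = U * (L : ℝ) ^ 2 + g / (L : ℝ) ^ 2 *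
          (star φ ⬝ᵥ (((pairField dWaveFormFactor L)ᴴ * pairField dWaveFormFactor L) *ᵥ φ)).re := by
      field_simp
    rw [e]
    linarith
  exact le_of_mul_le_mul_right key hL2

/-- **Theorem 36(b) (`U = 0`, every ground state, all fillings).** For `L ≥ 3`, `g ≥ 0`, `n ≤ L²` and
every normalised ground state `φ` of the free crutched Hamiltonian
`hubbardTorus 2 L 1 0 - (g/L²) Δ_dᴴΔ_d` in the sector `(2n, S^z = 0)`:
`re⟨φ, Δ_dᴴΔ_d φ⟩ ≤ max (4608 L²) (2³⁰ g² L⁴)` — the pair-order density is `O(g²)` uniformly over the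
ground-state manifold (at `g = 0` this is the all-families form of Theorem 4). [this work] -/
theorem free_crutch_groundState_pairField_le (hL : 3 ≤ L) {g : ℝ} (hg : 0 ≤ g) {n : ℕ} (hn : n ≤ L ^ 2)
    {φ : Fock (Orb (FermionTorus 2 L))} (hφ1 : star φ ⬝ᵥ φ = 1)
    (hφ : IsGroundStateInSector
      (hubbardTorus 2 L 1 0 + ((-(g / (L : ℝ) ^ 2) : ℝ) : ℂ) •
        ((pairField dWaveFormFactor L)ᴴ * pairField dWaveFormFactor L)) (2 * n) 0 φ) :
    (star φ ⬝ᵥ (((pairField dWaveFormFactor L)ᴴ * pairField dWaveFormFactor L) *ᵥ φ)).re ≤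
      max (4608 * (L : ℝ) ^ 2) (2 ^ 30 * g ^ 2 * (L : ℝ) ^ 4) := by
  have hL0 : (0 : ℝ) < L := by exact_mod_cast (by omega : 0 < L)
  have hL4 : (0 : ℝ) < (L : ℝ) ^ 4 := by positivity
  rcases le_or_gt ((star φ ⬝ᵥ (((pairField dWaveFormFactor L)ᴴ * pairField dWaveFormFactor L) *ᵥ
      φ)).re) (4608 * (L : ℝ) ^ 2) with hsmall | hbig
  · exact hsmall.trans (le_max_left _ _)
  refine le_trans ?_ (le_max_right _ _)
  -- the density `a = Y / L⁴`
  set Y := (star φ ⬝ᵥ (((pairField dWaveFormFactor L)ᴴ * pairField dWaveFormFactor L) *ᵥ φ)).re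
    with hY_def
  have hYpos : 0 < Y := lt_trans (by positivity) hbig
  have ha : 0 < Y / (L : ℝ) ^ 4 := div_pos hYpos hL4
  have hYa : Y / (L : ℝ) ^ 4 * (L : ℝ) ^ 4 = Y := div_mul_cancel₀ _ hL4.ne'
  have hY : Y / (L : ℝ) ^ 4 * (L : ℝ) ^ 4 ≤ Y := hYa.le
  have hLa : 4608 ≤ Y / (L : ℝ) ^ 4 * (L : ℝ) ^ 2 := by
    have e : Y / (L : ℝ) ^ 4 * (L : ℝ) ^ 2 = Y / (L : ℝ) ^ 2 := by
      field_simp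
    rw [e, le_div_iff₀ (by positivity)]
    exact hbig.le
  have h := crutch_groundState_pairDensity_opt hL le_rfl hg hn hφ1 hφ ha hLa hY
  -- `a √a / 32768 ≤ g a`, hence `√a ≤ 32768 g` and `a ≤ 2³⁰ g²`
  have hs : Real.sqrt (Y / (L : ℝ) ^ 4) ≤ 32768 * g := by
    have h' : Y / (L : ℝ) ^ 4 * Real.sqrt (Y / (L : ℝ) ^ 4) ≤ Y / (L : ℝ) ^ 4 * (32768 * g) := by
      linarith
    exact le_of_mul_le_mul_left h' ha
  have hsq : Y / (L : ℝ) ^ 4 ≤ 2 ^ 30 * g ^ 2 := by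
    nlinarith [Real.sq_sqrt ha.le, Real.sqrt_nonneg (Y / (L : ℝ) ^ 4), hs]
  calc Y = Y / (L : ℝ) ^ 4 * (L : ℝ) ^ 4 := hYa.symm
    _ ≤ 2 ^ 30 * g ^ 2 * (L : ℝ) ^ 4 := mul_le_mul_of_nonneg_right hsq hL4.le

/-- **Theorem 36(c) (summit fillings, logarithmic cost).** As in `crutch_groundState_pairDensity_opt`,
but with the Fermi level of the sector pinned into `[-4 + d₀, -d₀]` by the two counting hypotheses
`hC1`, `hC2` of `FreeFermiGasPairingCostLog.lean` (the summit's fillings `1 - δ`, `δ ∈ (0,1/2)`, have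
`d₀ ≍ δ²`, `TorusBandParticleHole.lean`), `a L² ≥ 12800`, `√d₀ L ≥ 40`:
`√d₀ · a/(4096 · log(4 + 32/√a)) ≤ U + g · re⟨φ, Δ_dᴴΔ_d φ⟩/L⁴`. [this work] -/
theorem crutch_groundState_pairDensity_log (hL : 3 ≤ L) {U : ℝ} (hU : 0 ≤ U) {g : ℝ} (hg : 0 ≤ g)
    {d₀ : ℝ} (hd : 0 < d₀) (hLd : 40 ≤ Real.sqrt d₀ * L)
    {n : ℕ} (hn : n ≤ L ^ 2)
    (hC1 : n ≤ (Finset.univ.filter fun k : TorusSite 2 L => torusBand L k ≤ -d₀).card)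
    (hC2 : (Finset.univ.filter fun k : TorusSite 2 L => torusBand L k < (-4 : ℝ) + d₀).card < n)
    {φ : Fock (Orb (FermionTorus 2 L))} (hφ1 : star φ ⬝ᵥ φ = 1)
    (hφ : IsGroundStateInSector
      (hubbardTorus 2 L 1 U + ((-(g / (L : ℝ) ^ 2) : ℝ) : ℂ) •
        ((pairField dWaveFormFactor L)ᴴ * pairField dWaveFormFactor L)) (2 * n) 0 φ)
    {a : ℝ} (ha : 0 < a) (hLa : 12800 ≤ a * (L : ℝ) ^ 2)
    (hY : a * (L : ℝ) ^ 4 ≤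
      (star φ ⬝ᵥ (((pairField dWaveFormFactor L)ᴴ * pairField dWaveFormFactor L) *ᵥ φ)).re) :
    Real.sqrt d₀ * a / (4096 * Real.log (4 + 32 / Real.sqrt a)) ≤
      U + g * ((star φ ⬝ᵥ (((pairField dWaveFormFactor L)ᴴ * pairField dWaveFormFactor L) *ᵥ φ)).re /
        (L : ℝ) ^ 4) := by
  have h1 := crutch_groundState_kineticExcess_le hL hU hg hn hφ1 hφ
  have h2 := freeDWavePairing_costs_energy_log_explicit ha hd hL hLa hLd hφ.1 hφ1 hC1 hC2 hY
  have hL0 : (0 : ℝ) < L := by exact_mod_cast (by omega : 0 < L)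
  have hL2 : (0 : ℝ) < (L : ℝ) ^ 2 := by positivity
  have key : Real.sqrt d₀ * a / (4096 * Real.log (4 + 32 / Real.sqrt a)) * (L : ℝ) ^ 2 ≤
      (U + g * ((star φ ⬝ᵥ (((pairField dWaveFormFactor L)ᴴ * pairField dWaveFormFactor L) *ᵥ
        φ)).re / (L : ℝ) ^ 4)) * (L : ℝ) ^ 2 := by
    have e : (U + g * ((star φ ⬝ᵥ (((pairField dWaveFormFactor L)ᴴ * pairField dWaveFormFactor L) *ᵥ
        φ)).re / (L : ℝ) ^ 4)) * (L : ℝ) ^ 2 = U * (L : ℝ) ^ 2 + g / (L : ℝ) ^ 2 *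
          (star φ ⬝ᵥ (((pairField dWaveFormFactor L)ᴴ * pairField dWaveFormFactor L) *ᵥ φ)).re := by
      field_simp
    rw [e]
    linarith
  exact le_of_mul_le_mul_right key hL2

/-- **Theorem 36(d) (`U = 0` edge, exponential form).** For `L ≥ 3`, `g > 0`, the summit-type
filling hypotheses of `crutch_groundState_pairDensity_log`, and every normalised ground state `φ` of
`hubbardTorus 2 L 1 0 - (g/L²) Δ_dᴴΔ_d` in the sector `(2n, 0)` whose pair order
`Y = re⟨φ, Δ_dᴴΔ_d φ⟩` is at least `12800 L²`: with `y = Y/L⁴`,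
`exp(√d₀/(4096 g)) ≤ 4 + 32/√y` — so `y ≤ 1024/(exp(√d₀/(4096 g)) - 4)²` as soon as the exponential
exceeds `4`: order density `e^{-Θ(1/g)}` along the whole `U = 0` edge, for every ground state. [this work] -/
theorem free_crutch_groundState_exp_le (hL : 3 ≤ L) {g : ℝ} (hg : 0 < g) {d₀ : ℝ} (hd : 0 < d₀)
    (hLd : 40 ≤ Real.sqrt d₀ * L) {n : ℕ} (hn : n ≤ L ^ 2)
    (hC1 : n ≤ (Finset.univ.filter fun k : TorusSite 2 L => torusBand L k ≤ -d₀).card)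
    (hC2 : (Finset.univ.filter fun k : TorusSite 2 L => torusBand L k < (-4 : ℝ) + d₀).card < n)
    {φ : Fock (Orb (FermionTorus 2 L))} (hφ1 : star φ ⬝ᵥ φ = 1)
    (hφ : IsGroundStateInSector
      (hubbardTorus 2 L 1 0 + ((-(g / (L : ℝ) ^ 2) : ℝ) : ℂ) •
        ((pairField dWaveFormFactor L)ᴴ * pairField dWaveFormFactor L)) (2 * n) 0 φ)
    (hbig : 12800 * (L : ℝ) ^ 2 ≤
      (star φ ⬝ᵥ (((pairField dWaveFormFactor L)ᴴ * pairField dWaveFormFactor L) *ᵥ φ)).re) :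
    Real.exp (Real.sqrt d₀ / (4096 * g)) ≤
      4 + 32 / Real.sqrt ((star φ ⬝ᵥ (((pairField dWaveFormFactor L)ᴴ * pairField dWaveFormFactor L) *ᵥ
        φ)).re / (L : ℝ) ^ 4) := by
  have hL0 : (0 : ℝ) < L := by exact_mod_cast (by omega : 0 < L)
  have hL4 : (0 : ℝ) < (L : ℝ) ^ 4 := by positivity
  set Y := (star φ ⬝ᵥ (((pairField dWaveFormFactor L)ᴴ * pairField dWaveFormFactor L) *ᵥ φ)).re
    with hY_def
  have hYpos : 0 < Y := lt_of_lt_of_le (by positivity) hbig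
  have ha : 0 < Y / (L : ℝ) ^ 4 := div_pos hYpos hL4
  have hYa : Y / (L : ℝ) ^ 4 * (L : ℝ) ^ 4 = Y := div_mul_cancel₀ _ hL4.ne'
  have hY : Y / (L : ℝ) ^ 4 * (L : ℝ) ^ 4 ≤ Y := hYa.le
  have hLa : 12800 ≤ Y / (L : ℝ) ^ 4 * (L : ℝ) ^ 2 := by
    have e : Y / (L : ℝ) ^ 4 * (L : ℝ) ^ 2 = Y / (L : ℝ) ^ 2 := by
      field_simp
    rw [e, le_div_iff₀ (by positivity)]
    exact hbig
  have h := crutch_groundState_pairDensity_log hL le_rfl hg.le hd hLd hn hC1 hC2 hφ1 hφ ha hLa hY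
  -- `h : √d₀ a /(4096 log) ≤ 0 + g a`; divide by `a`
  have hlogpos : 0 < Real.log (4 + 32 / Real.sqrt (Y / (L : ℝ) ^ 4)) :=
    Real.log_pos (by
      have : (0 : ℝ) ≤ 32 / Real.sqrt (Y / (L : ℝ) ^ 4) := by positivity
      linarith)
  have h' : Real.sqrt d₀ / (4096 * Real.log (4 + 32 / Real.sqrt (Y / (L : ℝ) ^ 4))) *
      (Y / (L : ℝ) ^ 4) ≤ g * (Y / (L : ℝ) ^ 4) := by
    have e : Real.sqrt d₀ / (4096 * Real.log (4 + 32 / Real.sqrt (Y / (L : ℝ) ^ 4))) *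
        (Y / (L : ℝ) ^ 4) =
        Real.sqrt d₀ * (Y / (L : ℝ) ^ 4) /
          (4096 * Real.log (4 + 32 / Real.sqrt (Y / (L : ℝ) ^ 4))) := by ring
    rw [e]
    linarith
  have h'' := le_of_mul_le_mul_right h' ha
  rw [div_le_iff₀ (by positivity)] at h''
  have h4 : (0 : ℝ) < 4 + 32 / Real.sqrt (Y / (L : ℝ) ^ 4) := by
    have : (0 : ℝ) ≤ 32 / Real.sqrt (Y / (L : ℝ) ^ 4) := by positivity
    linarith
  rw [← Real.le_log_iff_exp_le h4, div_le_iff₀ (by positivity)]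
  linarith

end Summit.HubbardSuperconductivity.HubbardSuperconductivity.Theorems.CrutchCorner
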